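import Mathlib
import Literature.NumberTheory.LFunctions.Zhang2022.Section11AFEObjects
import Literature.NumberTheory.LFunctions.Zhang2022.Section6LFunctionStripGrowth
import Literature.Analysis.Complex.VerticalLineShift
import HarnessLib

/-!
# Zhang (2022) §11, proof of Lemma 11.2 for `χψ` — sub-step (b) of `Z22:§11.u024` PROVED:
# "moving the line of integration to `u = −1`" (`Z22:§6.u008` for `χψ`), the node `ShiftPole11`

Topic `Literature/NumberTheory/LFunctions/Zhang2022` (Landau–Siegel audit tree; verdict-neutral).
Y. Zhang, arXiv:2211.02515v1 (2022) [Zhang2022LandauSiegel] — **an unrefereed manuscript under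
adjudication** (campaign D-0069; nothing here bears on Theorems 1–2 or on Landau–Siegel zeros).
PROVED: `shiftPole11_holds : ShiftPole11` (`D ≥ 3`): `(1/2πi)∫_{(1)} L(s+w,χψ)X^wω₁(w)dw/w =
L(s,χψ) + (1/2πi)∫_{(−1)} …`. Route: integrand `= G(w) + L(s,χψ)X^wω₁(w)/w`, `G = poleRemoved` ENTIRE
(`differentiable_poleRemoved`, Mathlib's `dslope`), `G = O(1/(1+v²))` on `|u| ≤ 1`
(`exists_norm_poleRemoved_le`: the tree's `StripGrowth.exists_norm_LFunction_le_pow` against the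
Gaussian), so `∫_{(1)}G = ∫_{(−1)}G` (the tree's `integral_vertical_eq_of_differentiableOn`), and
`(1/2πi)∫_{(±1)}X^wω₁(w)dw/w = g(X), g(X) − 1` ((4.1), (11.4)).
[cite: Zhang2022LandauSiegel, §6 Lemma 6.1 (proof) p. 31, tex L1711; §11 Lemma 11.2 p. 65]
-/

noncomputable section

open Complex Real ComplexConjugate MeasureTheory Set Filter Topology

namespace Literature.NumberTheory.LFunctions.Zhang2022.Section11AFE

open Skeleton GaussWeight Section6Statements

section BlockB

variable {D : ℕ} [NeZero D] (χ : DirichletCharacter ℂ D) (x : Chr D)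

omit [NeZero D] in
/-- `e^{u} ≥ u³/27` for `u ≥ 0`. [folklore] -/
private theorem cube_le_exp {u : ℝ} (hu : 0 ≤ u) : u ^ 3 / 27 ≤ Real.exp u := by
  have h1 : u / 3 ≤ Real.exp (u / 3) := by
    have := Real.add_one_le_exp (u / 3); linarith
  have h3 : Real.exp u = Real.exp (u / 3) ^ 3 := by rw [← Real.exp_nat_mul]; congr 1; ring
  rw [h3, show u ^ 3 / 27 = (u / 3) ^ 3 by ring]
  exact pow_le_pow_left₀ (by positivity) h1 3

omit [NeZero D] in
/-- Polynomial times Gaussian is bounded: `(1+|y|)⁶e^{−by²} ≤ 64 + 1728/b³` (`b > 0`).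
[folklore] -/
private theorem poly6_mul_gauss_le {b : ℝ} (hb : 0 < b) (y : ℝ) :
    (1 + |y|) ^ 6 * Real.exp (-b * y ^ 2) ≤ 64 + 1728 / b ^ 3 := by
  have hK : 0 ≤ 1728 / b ^ 3 := by positivity
  rcases le_or_gt |y| 1 with h | h
  · have h1 : (1 + |y|) ^ 6 ≤ 2 ^ 6 := pow_le_pow_left₀ (by positivity) (by linarith) 6
    have h2 : Real.exp (-b * y ^ 2) ≤ 1 := by
      rw [Real.exp_le_one_iff]; nlinarith [sq_nonneg y]
    calc (1 + |y|) ^ 6 * Real.exp (-b * y ^ 2) ≤ 2 ^ 6 * 1 := mul_le_mul h1 h2 (Real.exp_nonneg _) (by positivity)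
      _ ≤ 64 + 1728 / b ^ 3 := by norm_num; linarith
  · have hy2 : y ^ 2 = |y| ^ 2 := (sq_abs y).symm
    have hy2pos : 0 < y ^ 2 := by rw [hy2]; positivity
    have hexp : (b * y ^ 2) ^ 3 / 27 ≤ Real.exp (b * y ^ 2) := cube_le_exp (by positivity)
    have hpos : 0 < (b * y ^ 2) ^ 3 / 27 := div_pos (pow_pos (mul_pos hb hy2pos) 3) (by norm_num)
    have h1 : (1 + |y|) ^ 6 ≤ (2 * |y|) ^ 6 := pow_le_pow_left₀ (by positivity) (by linarith) 6
    have h2 : Real.exp (-b * y ^ 2) ≤ 27 / (b * y ^ 2) ^ 3 := by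
      rw [show -b * y ^ 2 = -(b * y ^ 2) by ring, Real.exp_neg]
      have := one_div_le_one_div_of_le hpos hexp
      rw [one_div, one_div_div] at this
      exact this
    calc (1 + |y|) ^ 6 * Real.exp (-b * y ^ 2) ≤ (2 * |y|) ^ 6 * (27 / (b * y ^ 2) ^ 3) :=
          mul_le_mul h1 h2 (Real.exp_nonneg _) (by positivity)
      _ = 1728 / b ^ 3 := by
          rw [hy2]; have : |y| ≠ 0 := by linarith
          field_simp; ring
      _ ≤ 64 + 1728 / b ^ 3 := by linarith

omit [NeZero D] in
/-- `g(x) + g(1/x) = 1` ((11.4) of the source; the Gaussian is even).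
[cite: Zhang2022LandauSiegel, §11 (11.4) p. 63] -/
theorem gW_add_gW_inv (hD : 2 ≤ D) (y : ℝ) : gW D y + gW D y⁻¹ = 1 := by
  have hΛ : 0 < ell D ^ 30 := pow_pos (by
    have : (1 : ℝ) < D := by exact_mod_cast hD
    exact Real.log_pos this) _
  rw [gW, gW, gWeight_eq_integral_Ioi (x := y⁻¹), Real.log_inv, neg_neg]
  have := one_sub_gWeight hΛ y
  linarith

/-- The pole-free part of the Perron integrand: **`G(w) = (L(s+w,χψ) − L(s,χψ))/w · X^wω₁(w)`**
(at `w = 0` the difference quotient is the derivative), the §6 integrand minus `L(s,χψ)X^wω₁(w)/w`.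
[cite: Zhang2022LandauSiegel, §6 p. 31, tex L1711] -/
def poleRemoved (X : ℝ) (s w : ℂ) : ℂ :=
  dslope (fun w => (psiChi χ x).LFunction (s + w)) 0 w * (((X : ℝ) : ℂ) ^ w * omega1 (ell D ^ 30) w)

/-- `G` is entire (`ψχ ≠ 1`, so `L(·,χψ)` is entire; the difference quotient extends analytically).
[cite: Zhang2022LandauSiegel, §6 p. 31] -/
theorem differentiable_poleRemoved (hD : 3 ≤ D) (hp : χ.IsPrimitive) (s : ℂ) {X : ℝ} (hX : 0 < X) :
    Differentiable ℂ (poleRemoved χ x X s) := by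
  have hprim : (psiChi χ x).IsPrimitive := psiChiPrimitive_holds D χ x hD hp
  have hk1 : D * x.p ≠ 1 := by
    intro h; have := Nat.eq_one_of_mul_eq_one_right h; omega
  have hθ1 : psiChi χ x ≠ 1 := GammaFactor.ne_one_of_isPrimitive hprim hk1
  have hΦd : Differentiable ℂ (fun w => (psiChi χ x).LFunction (s + w)) :=
    (DirichletCharacter.differentiable_LFunction hθ1).comp
      ((differentiable_const s).add differentiable_id)
  have hXne : ((X : ℝ) : ℂ) ≠ 0 := Complex.ofReal_ne_zero.mpr hX.ne'
  have hEd : Differentiable ℂ fun w : ℂ => ((X : ℝ) : ℂ) ^ w * omega1 (ell D ^ 30) w := by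
    have h1 : Differentiable ℂ fun w : ℂ => ((X : ℝ) : ℂ) ^ w :=
      fun w => DifferentiableAt.const_cpow differentiableAt_id (Or.inl hXne)
    have h2 : Differentiable ℂ fun w : ℂ => omega1 (ell D ^ 30) w := by
      unfold omega1; fun_prop
    exact h1.mul h2
  have hds : Differentiable ℂ (dslope (fun w => (psiChi χ x).LFunction (s + w)) 0) := by
    intro w
    by_cases hw : w = 0
    · subst hw
      obtain ⟨p, hp⟩ := hΦd.analyticAt 0
      exact hp.has_fpower_series_dslope_fslope.analyticAt.differentiableAt
    · exact (differentiableAt_dslope_of_ne hw).mpr (hΦd w)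
  unfold poleRemoved
  exact hds.mul hEd

/-- Off `w = 0` the Perron integrand is `G(w) + L(s,χψ)X^wω₁(w)/w`.
[cite: Zhang2022LandauSiegel, §6 p. 31] -/
theorem integrandL_eq_poleRemoved_add (X : ℝ) (s : ℂ) {w : ℂ} (hw : w ≠ 0) :
    integrandL χ x X s w = poleRemoved χ x X s w + (psiChi χ x).LFunction s * kern D X w := by
  have hds : dslope (fun w => (psiChi χ x).LFunction (s + w)) 0 w =
      ((psiChi χ x).LFunction (s + w) - (psiChi χ x).LFunction (s + 0)) / w := by
    rw [dslope_of_ne _ hw, slope_def_field, sub_zero]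
  rw [integrandL, poleRemoved, hds, kern, add_zero]
  field_simp
  ring

/-- The size of `L(s+w,χψ)` on the strip `|Re w| ≤ 1` (`σ = 1/2`): `≤ C_L(T(1+|Im w|))⁴`,
`T = |t| + 3` (the tree's `StripGrowth.exists_norm_LFunction_le_pow`, `A = 2`).
[cite: Zhang2022LandauSiegel, §6 p. 31] -/
theorem exists_norm_LFunction_shift_le (hD : 3 ≤ D) (hp : χ.IsPrimitive) {s : ℂ} (hs : s.re = 1 / 2) :
    ∃ CL : ℝ, 0 < CL ∧ ∀ w : ℂ, |w.re| ≤ 1 →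
      ‖(psiChi χ x).LFunction (s + w)‖ ≤ CL * ((|s.im| + 3) * (1 + |w.im|)) ^ 4 := by
  have hprim : (psiChi χ x).IsPrimitive := psiChiPrimitive_holds D χ x hD hp
  have hk1 : D * x.p ≠ 1 := by
    intro h; have := Nat.eq_one_of_mul_eq_one_right h; omega
  obtain ⟨CL, hCL0, hCL⟩ := StripGrowth.exists_norm_LFunction_le_pow hprim hk1 (A := 2) (by norm_num)
  refine ⟨CL, hCL0, fun w hw => ?_⟩
  have hre2 : |(s + w).re| ≤ (2 : ℕ) := by
    simp only [Complex.add_re, hs, Nat.cast_ofNat]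
    have := abs_le.mp hw
    rw [abs_le]; constructor <;> linarith
  refine (hCL (s + w) hre2).trans ?_
  have hi : |(s + w).im| + (2 : ℕ) + 1 ≤ (|s.im| + 3) * (1 + |w.im|) := by
    simp only [Complex.add_im, Nat.cast_ofNat]
    have := abs_add_le s.im w.im
    nlinarith [abs_nonneg s.im, abs_nonneg w.im]
  have hi0 : 0 ≤ |(s + w).im| + (2 : ℕ) + 1 := by positivity
  rw [show (2 + 2 : ℕ) = 4 from rfl]
  exact mul_le_mul_of_nonneg_left (pow_le_pow_left₀ hi0 hi 4) hCL0.le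

omit [NeZero D] in
/-- The size of `X^wω₁(w)` on the strip `|Re w| ≤ 1`: `≤ e^{|log X|}e^{b}e^{−b(Im w)²}`, `b = 1/(4𝓛³⁰)`.
[cite: Zhang2022LandauSiegel, §6 p. 32 ("a trivial bound for `ω₁(w)`")] -/
theorem norm_cpow_mul_omega1_le {X : ℝ} (hX : 0 < X) {Λ : ℝ} (hΛ : 0 < Λ) {w : ℂ} (hw : |w.re| ≤ 1) :
    ‖((X : ℝ) : ℂ) ^ w * omega1 Λ w‖ ≤
      Real.exp |Real.log X| * Real.exp (1 / (4 * Λ)) * Real.exp (-(1 / (4 * Λ)) * w.im ^ 2) := by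
  have hw' := abs_le.mp hw
  have hXn : ‖((X : ℝ) : ℂ) ^ w‖ ≤ Real.exp |Real.log X| := by
    rw [Complex.norm_cpow_eq_rpow_re_of_pos hX, Real.rpow_def_of_pos hX]
    refine Real.exp_le_exp.mpr ?_
    calc Real.log X * w.re ≤ |Real.log X * w.re| := le_abs_self _
      _ = |Real.log X| * |w.re| := abs_mul _ _
      _ ≤ |Real.log X| * 1 := by gcongr
      _ = |Real.log X| := mul_one _
  have hω : ‖omega1 Λ w‖ = Real.exp ((w.re ^ 2 - w.im ^ 2) / (4 * Λ)) := by
    have := norm_omega1 Λ w.re w.im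
    rw [show ((w.re : ℝ) : ℂ) + (w.im : ℝ) * I = w from Complex.re_add_im w] at this
    exact this
  have hω' : ‖omega1 Λ w‖ ≤ Real.exp (1 / (4 * Λ)) * Real.exp (-(1 / (4 * Λ)) * w.im ^ 2) := by
    rw [hω, ← Real.exp_add]
    refine Real.exp_le_exp.mpr ?_
    have hre1 : w.re ^ 2 ≤ 1 := by nlinarith
    have h4 : 0 < 4 * Λ := by positivity
    have : (w.re ^ 2 - w.im ^ 2) / (4 * Λ) = w.re ^ 2 * (1 / (4 * Λ)) + -(1 / (4 * Λ)) * w.im ^ 2 := by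
      field_simp; ring
    rw [this]
    have h1 : 0 < 1 / (4 * Λ) := by positivity
    nlinarith
  calc ‖((X : ℝ) : ℂ) ^ w * omega1 Λ w‖ = ‖((X : ℝ) : ℂ) ^ w‖ * ‖omega1 Λ w‖ := norm_mul _ _
    _ ≤ Real.exp |Real.log X| * (Real.exp (1 / (4 * Λ)) * Real.exp (-(1 / (4 * Λ)) * w.im ^ 2)) :=
        mul_le_mul hXn hω' (norm_nonneg _) (Real.exp_nonneg _)
    _ = _ := by ring

/-- **`G(w) = O(1/(1+(Im w)²))` uniformly on the strip `|Re w| ≤ 1`** (Gaussian decay of `ω₁`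
against the polynomial growth of `L(·,χψ)`; near `w = 0`, continuity on a compact square).
[cite: Zhang2022LandauSiegel, §6 p. 31] -/
theorem exists_norm_poleRemoved_le (hD : 3 ≤ D) (hp : χ.IsPrimitive) {s : ℂ} (hs : s.re = 1 / 2)
    {X : ℝ} (hX : 0 < X) :
    ∃ C : ℝ, ∀ xx y : ℝ, xx ∈ Set.Icc (-1 : ℝ) 1 →
      ‖poleRemoved χ x X s ((xx : ℂ) + (y : ℂ) * I)‖ ≤ C / (1 + y ^ 2) := by
  have hD2 : 2 ≤ D := le_trans (by norm_num) hD
  have hℓ : 0 < ell D := by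
    have : (1 : ℝ) < D := by exact_mod_cast lt_of_lt_of_le (by norm_num) hD2
    exact Real.log_pos this
  set Λ : ℝ := ell D ^ 30 with hΛdef
  have hΛ : 0 < Λ := pow_pos hℓ 30
  set b : ℝ := 1 / (4 * Λ) with hbdef
  have hb : 0 < b := by rw [hbdef]; positivity
  obtain ⟨CL, hCL0, hΦb⟩ := exists_norm_LFunction_shift_le χ x hD hp hs
  set T : ℝ := |s.im| + 3 with hT
  have hT1 : 1 ≤ T := by rw [hT]; linarith [abs_nonneg s.im]
  have hGd := differentiable_poleRemoved χ x hD hp s hX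
  -- compact part
  have hK : IsCompact (Set.Icc (-1 : ℝ) 1 ×ℂ Set.Icc (-1 : ℝ) 1) := isCompact_Icc.reProdIm isCompact_Icc
  obtain ⟨M, hM⟩ := hK.exists_bound_of_continuousOn hGd.continuous.continuousOn
  have hM0 : 0 ≤ M := le_trans (norm_nonneg _) (hM 0 (by
    rw [Complex.mem_reProdIm]; exact ⟨by simp, by simp⟩))
  set K₁ : ℝ := 2 * CL * T ^ 4 * (Real.exp |Real.log X| * Real.exp b) * (64 + 1728 / b ^ 3) with hK₁
  have hK₁0 : 0 ≤ K₁ := by rw [hK₁]; positivity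
  refine ⟨2 * M + K₁, fun xx y hxx => ?_⟩
  have hxx' : |xx| ≤ 1 := abs_le.mpr ⟨by linarith [hxx.1], hxx.2⟩
  set w : ℂ := (xx : ℂ) + (y : ℂ) * I with hw
  have hwre : w.re = xx := by simp [hw]
  have hwim : w.im = y := by simp [hw]
  have h1y : 0 < 1 + y ^ 2 := by positivity
  rcases le_or_gt |y| 1 with hy | hy
  · -- compact part
    have hmem : w ∈ Set.Icc (-1 : ℝ) 1 ×ℂ Set.Icc (-1 : ℝ) 1 := by
      rw [Complex.mem_reProdIm, hwre, hwim]
      exact ⟨hxx, abs_le.mp hy⟩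
    have h := hM _ hmem
    rw [le_div_iff₀ h1y]
    have hy2 : y ^ 2 ≤ 1 := by nlinarith [abs_le.mp hy, sq_abs y]
    nlinarith [norm_nonneg (poleRemoved χ x X s w)]
  · -- tail part
    have hw0 : w ≠ 0 := by
      intro h; have := congrArg Complex.im h; rw [hwim] at this
      simp only [Complex.zero_im] at this
      rw [this, abs_zero] at hy; linarith
    have hwn : 1 ≤ ‖w‖ := le_trans hy.le (by rw [← hwim]; exact Complex.abs_im_le_norm w)
    set Φ : ℂ → ℂ := fun w => (psiChi χ x).LFunction (s + w) with hΦ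
    have hds : dslope Φ 0 w = (Φ w - Φ 0) / w := by
      rw [dslope_of_ne _ hw0, slope_def_field, sub_zero]
    have hdsb : ‖dslope Φ 0 w‖ ≤ ‖Φ w‖ + ‖Φ 0‖ := by
      rw [hds, norm_div]
      calc ‖Φ w - Φ 0‖ / ‖w‖ ≤ ‖Φ w - Φ 0‖ / 1 :=
            div_le_div_of_nonneg_left (norm_nonneg _) one_pos hwn
        _ = ‖Φ w - Φ 0‖ := div_one _
        _ ≤ ‖Φ w‖ + ‖Φ 0‖ := norm_sub_le _ _
    have hΦw : ‖Φ w‖ ≤ CL * (T * (1 + |y|)) ^ 4 := by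
      have := hΦb w (by rw [hwre]; exact hxx')
      rw [hwim] at this; exact this
    have hΦ0 : ‖Φ 0‖ ≤ CL * (T * (1 + |y|)) ^ 4 := by
      have h0 := hΦb 0 (by simp)
      simp only [Complex.zero_im, abs_zero, add_zero, mul_one] at h0
      have hT4 : CL * T ^ 4 ≤ CL * (T * (1 + |y|)) ^ 4 := by
        refine mul_le_mul_of_nonneg_left ?_ hCL0.le
        rw [mul_pow]
        exact le_mul_of_one_le_right (by positivity) (one_le_pow₀ (by linarith [abs_nonneg y]))
      have hΦ00 : Φ 0 = (psiChi χ x).LFunction s := by simp only [hΦ, add_zero]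
      rw [hΦ00]
      exact h0.trans hT4
    have hdsb' : ‖dslope Φ 0 w‖ ≤ 2 * CL * T ^ 4 * (1 + |y|) ^ 4 := by
      calc ‖dslope Φ 0 w‖ ≤ ‖Φ w‖ + ‖Φ 0‖ := hdsb
        _ ≤ CL * (T * (1 + |y|)) ^ 4 + CL * (T * (1 + |y|)) ^ 4 := add_le_add hΦw hΦ0
        _ = 2 * CL * T ^ 4 * (1 + |y|) ^ 4 := by ring
    have hEw : ‖((X : ℝ) : ℂ) ^ w * omega1 Λ w‖ ≤
        Real.exp |Real.log X| * Real.exp b * Real.exp (-b * y ^ 2) := by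
      have := norm_cpow_mul_omega1_le hX hΛ (w := w) (by rw [hwre]; exact hxx')
      rw [hwim, ← hbdef] at this; exact this
    have hG1 : ‖poleRemoved χ x X s w‖ ≤ 2 * CL * T ^ 4 * (1 + |y|) ^ 4 *
        (Real.exp |Real.log X| * Real.exp b * Real.exp (-b * y ^ 2)) := by
      rw [poleRemoved, norm_mul]
      exact mul_le_mul hdsb' hEw (norm_nonneg _) (by positivity)
    have hpg := poly6_mul_gauss_le hb y
    have h6 : (1 + |y|) ^ 4 * Real.exp (-b * y ^ 2) * (1 + y ^ 2) ≤ 64 + 1728 / b ^ 3 := by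
      have hsq : 1 + y ^ 2 ≤ (1 + |y|) ^ 2 := by rw [← sq_abs y]; nlinarith [abs_nonneg y]
      calc (1 + |y|) ^ 4 * Real.exp (-b * y ^ 2) * (1 + y ^ 2)
          ≤ (1 + |y|) ^ 4 * Real.exp (-b * y ^ 2) * (1 + |y|) ^ 2 := by gcongr
        _ = (1 + |y|) ^ 6 * Real.exp (-b * y ^ 2) := by ring
        _ ≤ 64 + 1728 / b ^ 3 := hpg
    rw [le_div_iff₀ h1y]
    set P : ℝ := Real.exp |Real.log X| * Real.exp b with hP
    have hP0 : 0 ≤ P := by rw [hP]; positivity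
    calc ‖poleRemoved χ x X s w‖ * (1 + y ^ 2)
        ≤ (2 * CL * T ^ 4 * (1 + |y|) ^ 4 * (P * Real.exp (-b * y ^ 2))) * (1 + y ^ 2) := by
          rw [hP]; exact mul_le_mul_of_nonneg_right hG1 h1y.le
      _ = 2 * CL * T ^ 4 * P * ((1 + |y|) ^ 4 * Real.exp (-b * y ^ 2) * (1 + y ^ 2)) := by ring
      _ ≤ 2 * CL * T ^ 4 * P * (64 + 1728 / b ^ 3) :=
          mul_le_mul_of_nonneg_left h6 (by positivity)
      _ = K₁ := by rw [hK₁, hP]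
      _ ≤ 2 * M + K₁ := by linarith

omit [NeZero D] in
/-- `(1/2πi)∫_{(1)} X^wω₁(w)dw/w = g(X)` and `(1/2πi)∫_{(−1)} X^wω₁(w)dw/w = −g(1/X) = g(X) − 1`
(times `2π`), with integrability ((4.1); "the change of variable `w → −w`").
[cite: Zhang2022LandauSiegel, §4 (4.1); §6 p. 32] -/
theorem integral_kern_lines (hD : 2 ≤ D) {X : ℝ} (hX : 0 < X) :
    (∫ y : ℝ, kern D X (((1 : ℝ) : ℂ) + (y : ℂ) * I)) = 2 * π * (gW D X : ℂ) ∧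
      (∫ y : ℝ, kern D X (((-1 : ℝ) : ℂ) + (y : ℂ) * I)) = -(2 * π * (gW D X⁻¹ : ℂ)) ∧
      Integrable (fun y : ℝ => kern D X (((1 : ℝ) : ℂ) + (y : ℂ) * I)) ∧
      Integrable (fun y : ℝ => kern D X (((-1 : ℝ) : ℂ) + (y : ℂ) * I)) := by
  have hΛ : 0 < ell D ^ 30 := pow_pos (by
    have : (1 : ℝ) < D := by exact_mod_cast hD
    exact Real.log_pos this) _
  have e1 : (fun y : ℝ => kern D X (((1 : ℝ) : ℂ) + (y : ℂ) * I)) = kernel (ell D ^ 30) 1 X := by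
    funext y; rfl
  have e2 : (fun y : ℝ => kern D X (((-1 : ℝ) : ℂ) + (y : ℂ) * I)) =
      fun y => -kernel (ell D ^ 30) 1 X⁻¹ (-y) := by
    funext y; exact kern_neg_line hX 1 y
  refine ⟨?_, ?_, ?_, ?_⟩
  · rw [e1, GaussWeight.integral_kernel' hΛ one_pos hX, gW]
  · rw [e2, integral_neg, integral_neg_eq_self (fun y => kernel (ell D ^ 30) 1 X⁻¹ y) volume,
      GaussWeight.integral_kernel' hΛ one_pos (inv_pos.mpr hX), gW]
  · rw [e1]; exact GaussWeight.integrable_kernel hΛ one_pos hX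
  · rw [e2]; exact ((GaussWeight.integrable_kernel hΛ one_pos (inv_pos.mpr hX)).comp_neg).neg

omit [NeZero D] in
/-- Shifting a vertical line integral across a pole-free strip under a uniform `O(1/(1+y²))`
bound (corollary of the tree's `Literature.Analysis.Complex.integral_vertical_eq_of_differentiableOn`;
adapted from the tree's `HorocycleRHMellinShift.integral_vertical_eq_of_norm_le_div`). [folklore] -/
private theorem integral_vertical_eq_of_norm_le_div' {f : ℂ → ℂ} {σ₁ σ₂ C : ℝ} (hσ : σ₁ ≤ σ₂)
    (hd : DifferentiableOn ℂ f (Complex.re ⁻¹' Set.Icc σ₁ σ₂))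
    (hb : ∀ x y : ℝ, x ∈ Set.Icc σ₁ σ₂ → ‖f (x + y * I)‖ ≤ C / (1 + y ^ 2)) :
    ∫ y : ℝ, f (σ₁ + y * I) = ∫ y : ℝ, f (σ₂ + y * I) := by
  have hC0 : 0 ≤ C := by
    have h := (norm_nonneg _).trans (hb σ₁ 0 (Set.left_mem_Icc.2 hσ))
    simpa using h
  have hint : ∀ x ∈ Set.Icc σ₁ σ₂, Integrable fun y : ℝ => f (x + y * I) := by
    intro x hx
    have hcont : Continuous fun y : ℝ => f (x + y * I) := by
      refine hd.continuousOn.comp_continuous (by fun_prop) ?_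
      intro y
      simpa using hx
    refine Integrable.mono' ((integrable_inv_one_add_sq).const_mul C) hcont.aestronglyMeasurable ?_
    filter_upwards with y
    simpa [div_eq_mul_inv] using hb x y hx
  refine Literature.Analysis.Complex.integral_vertical_eq_of_differentiableOn hσ hd
    (hint σ₁ (Set.left_mem_Icc.2 hσ)) (hint σ₂ (Set.right_mem_Icc.2 hσ)) fun ε hε => ?_
  refine ⟨max (C / ε) 1, fun T hT x hx => (hb x T hx).trans ?_⟩
  have hT1 : 1 ≤ |T| := (le_max_right _ _).trans hT
  have hT2 : C / ε ≤ |T| := (le_max_left _ _).trans hT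
  rw [div_le_iff₀ (by positivity)]
  have h1 : C ≤ ε * |T| := by rwa [div_le_iff₀' hε] at hT2
  have h2 : |T| ≤ 1 + T ^ 2 := by nlinarith [sq_abs T, abs_nonneg T]
  nlinarith

/-- **(b) PROVED**: the node `ShiftPole11` holds (for `D ≥ 3`) — `Z22:§6.u008` for `χψ`: "moving the
line of integration to `u = −1`", the pole of `L(s+w,χψ)X^wω₁(w)/w` at `w = 0` having residue
`L(s,χψ)`: `∫_{(1)}G = ∫_{(−1)}G` for the pole-free part (the tree's
`integral_vertical_eq_of_norm_le_div`) and `(1/2πi)∫_{(±1)}X^wω₁(w)dw/w = g(X), g(X) − 1`.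
[cite: Zhang2022LandauSiegel, §6 p. 31, tex L1711; §11 p. 65] -/
theorem shiftPole11_holds : ShiftPole11 := by
  refine ⟨3, fun D _ χ hD _hq hp x s hs z _hz1 _hz2 => ?_⟩
  obtain ⟨hre, _him⟩ := hs
  have hD2 : 2 ≤ D := le_trans (by norm_num) hD
  have hP : 0 < bigP D := Real.exp_pos _
  set X : ℝ := bigP D ^ z with hXdef
  have hX : 0 < X := Real.rpow_pos_of_pos hP z
  have hGd := differentiable_poleRemoved χ x hD hp s hX
  obtain ⟨C, hC⟩ := exists_norm_poleRemoved_le χ x hD hp hre hX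
  obtain ⟨hk1, hk2, hki1, hki2⟩ := integral_kern_lines (D := D) hD2 hX
  set L0 : ℂ := (psiChi χ x).LFunction s with hL0
  -- the shift for `G`
  have hshift : ∫ y : ℝ, poleRemoved χ x X s ((-1 : ℝ) + y * I) =
      ∫ y : ℝ, poleRemoved χ x X s ((1 : ℝ) + y * I) :=
    integral_vertical_eq_of_norm_le_div' (by norm_num) hGd.differentiableOn hC
  -- integrability of `G` on the two lines
  have hC0 : 0 ≤ C := by
    have h := hC 0 0 (by simp)
    have : (0 : ℝ) ≤ C / (1 + 0 ^ 2) := le_trans (norm_nonneg _) h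
    simpa using this
  have hGi : ∀ c : ℝ, c ∈ Set.Icc (-1 : ℝ) 1 →
      Integrable fun y : ℝ => poleRemoved χ x X s ((c : ℂ) + (y : ℂ) * I) := by
    intro c hc
    have hcont : Continuous fun y : ℝ => poleRemoved χ x X s ((c : ℂ) + (y : ℂ) * I) :=
      hGd.continuous.comp (by fun_prop)
    refine Integrable.mono' ((integrable_inv_one_add_sq).const_mul C) hcont.aestronglyMeasurable ?_
    filter_upwards with y
    simpa [div_eq_mul_inv] using hC c y hc
  -- the integrand on each line
  have e1 : (fun v : ℝ => integrandL χ x X s (((1 : ℝ) : ℂ) + (v : ℂ) * I)) = fun v : ℝ =>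
      poleRemoved χ x X s (((1 : ℝ) : ℂ) + (v : ℂ) * I) + L0 * kern D X (((1 : ℝ) : ℂ) + (v : ℂ) * I) := by
    funext v
    exact integrandL_eq_poleRemoved_add χ x X s (by
      intro h; have := congrArg Complex.re h; simp at this)
  have e2 : (fun v : ℝ => integrandL χ x X s (((-1 : ℝ) : ℂ) + (v : ℂ) * I)) = fun v : ℝ =>
      poleRemoved χ x X s (((-1 : ℝ) : ℂ) + (v : ℂ) * I) + L0 * kern D X (((-1 : ℝ) : ℂ) + (v : ℂ) * I) := by
    funext v
    exact integrandL_eq_poleRemoved_add χ x X s (by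
      intro h; have := congrArg Complex.re h; simp at this)
  have hg1 : (gW D X⁻¹ : ℂ) = 1 - (gW D X : ℂ) := by
    have h' : gW D X⁻¹ = 1 - gW D X := by linarith [gW_add_gW_inv (D := D) hD2 X]
    rw [h']; push_cast; ring
  have hπ : (2 * π : ℂ) ≠ 0 := by
    exact mul_ne_zero two_ne_zero (Complex.ofReal_ne_zero.mpr Real.pi_ne_zero)
  rw [vline, vline, e1, e2, integral_add (hGi 1 (by norm_num)) (hki1.const_mul _),
    integral_add (hGi (-1) (by norm_num)) (hki2.const_mul _), integral_const_mul,
    integral_const_mul, hk1, hk2, hg1]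
  rw [hshift]
  set J : ℂ := ∫ y : ℝ, poleRemoved χ x X s (((1 : ℝ) : ℂ) + (y : ℂ) * I) with hJ
  field_simp
  ring

/-- `ShiftPole11` — `_holds` alias of `shiftPole11_holds` above under the fact's exact name (appended
2026-08-28, D-0026 bookkeeping: the proof term is the existing theorem of this file; no statement,
definition or attribute is edited; no new named fact; the ledger's debt table listed the fact
unproved). [cite: Zhang2022LandauSiegel, §6 p. 31, tex L1711; §11 p. 65] -/
theorem _root_.Literature.NumberTheory.LFunctions.Zhang2022.Section11AFE.ShiftPole11_holds :
    ShiftPole11 :=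
  _root_.Literature.NumberTheory.LFunctions.Zhang2022.Section11AFE.shiftPole11_holds

end BlockB

end Literature.NumberTheory.LFunctions.Zhang2022.Section11AFE
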